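import Literature.MathematicalPhysics.QuantumFieldTheory.OSTimeContinuation
import Literature.Analysis.FunctionSpaces.TranslationInvariantDistribution
import HarnessLib

/-!
# The time continuation (A1) for one point: translation invariance makes `𝔖₁` a constant density

Topic `Literature/MathematicalPhysics/QuantumFieldTheory`; support file (all proved; no named
facts) for the discharge of (A1) `OS1975_exists_timeContinuation`: the case `n = 1` of H21's
statement. By E1 the one-point distribution `𝔖₁` is invariant under all translations, hence a
constant multiple of Lebesgue measure (the tree's
`TranslationInvariantDistribution.exists_eq_const_mul_integral_of_forall_compSubConstCLM`), after
transport from the configurations of one point to space-time. Then the constant function is the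
required `𝔚`. Osterwalder–Schrader II, §IV.2 Thm. 4.3 (trivial case).

* `timeContinuation_one` — the five conjuncts of (A1) for `n = 1`.

## References

* K. Osterwalder, R. Schrader, *Axioms for Euclidean Green's functions II*, Comm. Math. Phys.
  42 (1975) 281–305, §IV.2 Thm. 4.3. [OsterwalderSchraderCMP1975]
* M. Reed, B. Simon, *Methods of Modern Mathematical Physics II* (1975), §IX.1. [ReedSimonII1975]
-/

noncomputable section

open MeasureTheory Set Filter
open _root_.Topology
open scoped SchwartzMap

namespace Literature.MathematicalPhysics.QuantumFieldTheory

open Literature.MathematicalPhysics.QuantumLattice (SchwingerFamily SpaceTime complexifyPoint euclideanPoint IsTimeOrdered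
  succDiff translateMulti translateMulti_apply)
open Literature.Analysis.FunctionSpaces

/-! ### (A1) for one point -/

variable {d : ℕ}

/-- **(A1) for `n = 1`.** [cite: OsterwalderSchraderCMP1975, §IV.2 Thm. 4.3] -/
theorem timeContinuation_one [NeZero d] (S : SchwingerFamily (SpaceTime d)) (hE1 : S.IsEuclideanCovariant) :
    ∃ 𝔚 : (Fin 1 → Fin (d + 1) → ℂ) → ℂ,
      ContinuousOn 𝔚 (timeTube d 1) ∧ IsTimeHolomorphicOn 𝔚 (timeTube d 1) ∧
        (∀ z ∈ timeTube d 1, ∀ a : SpaceTime d, 𝔚 (fun k => z k + complexifyPoint a) = 𝔚 z) ∧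
        HasOSGrowth 𝔚 ∧
        ∀ F : 𝓢((Fin 1 → SpaceTime d), ℂ), IsTimeOrdered F →
          S 1 F = ∫ x : Fin 1 → SpaceTime d, 𝔚 (euclideanPoint x) * F x := by
  -- transport to space-time
  set e : (Fin 1 → SpaceTime d) ≃L[ℝ] SpaceTime d := ContinuousLinearEquiv.funUnique (Fin 1) ℝ (SpaceTime d) with he
  set pull : 𝓢(SpaceTime d, ℂ) →L[ℂ] 𝓢((Fin 1 → SpaceTime d), ℂ) := SchwartzMap.compCLMOfContinuousLinearEquiv ℂ e with hpull
  set push : 𝓢((Fin 1 → SpaceTime d), ℂ) →L[ℂ] 𝓢(SpaceTime d, ℂ) := SchwartzMap.compCLMOfContinuousLinearEquiv ℂ e.symm with hpush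
  have hpull_apply : ∀ (u : 𝓢(SpaceTime d, ℂ)) (y : Fin 1 → SpaceTime d), pull u y = u (y 0) := fun u y => by
    simp [hpull, he]
  have hpush_apply : ∀ (F : 𝓢((Fin 1 → SpaceTime d), ℂ)) (x : SpaceTime d), push F x = F (fun _ => x) := fun F x => by
    simp [hpush, he]
    rfl
  have hpp : ∀ F : 𝓢((Fin 1 → SpaceTime d), ℂ), pull (push F) = F := fun F => by
    ext y
    rw [hpull_apply, hpush_apply]
    congr 1
    funext i
    rw [Subsingleton.elim i 0]
  set T : 𝓢(SpaceTime d, ℂ) →L[ℂ] ℂ := (S 1).comp pull with hT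
  -- translation invariance of the transported distribution (E1)
  have hTinv : ∀ (a : SpaceTime d) (u : 𝓢(SpaceTime d, ℂ)), T (SchwartzMap.compSubConstCLM ℂ a u) = T u := by
    intro a u
    show S 1 (pull (SchwartzMap.compSubConstCLM ℂ a u)) = S 1 (pull u)
    have h1 : pull (SchwartzMap.compSubConstCLM ℂ a u) = translateMulti a (pull u) := by
      ext y
      rw [hpull_apply, SchwartzMap.compSubConstCLM_apply, translateMulti_apply, hpull_apply]
    rw [h1, hE1.translateMulti]
  obtain ⟨c, hc⟩ := exists_eq_const_mul_integral_of_forall_compSubConstCLM T hTinv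
  refine ⟨fun _ => c, continuousOn_const, fun z _ => differentiableOn_const _, fun _ _ _ => rfl,
    ⟨‖c‖, 0, fun z _ => by simp⟩, fun F _ => ?_⟩
  -- the Euclidean restriction
  have h1 : S 1 F = T (push F) := by show S 1 F = S 1 (pull (push F)); rw [hpp]
  rw [h1, hc, integral_const_mul]
  congr 1
  -- `∫_X F(x, …) dx = ∫_{X¹} F`
  have hmp := (volume_preserving_funUnique (Fin 1) (SpaceTime d)).integral_comp'
    (f := MeasurableEquiv.funUnique (Fin 1) (SpaceTime d)) (g := fun x : SpaceTime d => push F x)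
  simp only [MeasurableEquiv.funUnique_apply] at hmp
  rw [← hmp]
  refine integral_congr_ae (Eventually.of_forall fun y => ?_)
  show push F (y default) = F y
  rw [hpush_apply]
  congr 1
  funext i
  rw [Subsingleton.elim i default]

end Literature.MathematicalPhysics.QuantumFieldTheory
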